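import Summits.ABC.ABC.Theses.FeketeScales
import HarnessLib

/-!
# Route FeketeScales — crux `SparseGoodScales` (stmt-ABC-2161): geometric discretisation of the
# scale variable, and the "Silverman profile" form of the negation of the crux

Helper file (`--supports stmt-ABC-2161`) for the crux `SparseGoodScales` of route `FeketeScales`
(round-2 ideator 5's sorry-free package `Cruxes/SparseGoodScales/SketchIdeator5r2.lean`,
`BarrierNotes-r2-k5.md` R4), landed by the line lead in the tree's vocabulary, all statements
inline (no new definitions, no imports beyond the route file): "`R` is `δ`-good" is the sentence
`∀ a b c, IsABCTriple a b c → rad a b c ≤ R → (c : ℝ) ≤ (R : ℝ) ^ (1 + δ)` (the matrix of the crux;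
cf. `GoodScale` in `Theorems/SparseGoodScales/Negative/ScaleCensus.lean`), and "good powers of `q`
beyond every bound" is `∀ δ > 0, ∀ N, ∃ j ≥ N, (q ^ j is δ-good)`.

* `goodScale_pow_of_goodScale` — rounding a `δ/2`-good scale `R ∈ [q^j, q^{j+1})` down to `q^j`
  keeps it `δ`-good once `j ≥ 2/δ + 1` (the loss `q^{1+δ/2}` is absorbed by `δ/2 ↦ δ`);
* `geometric_of_sparseGoodScales` / `sparseGoodScales_of_geometric` /
  `sparseGoodScales_iff_geometric` — **for every base `q ≥ 2`, `SparseGoodScales` ↔ good POWERS of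
  `q` beyond every bound**: the crux may be decided along one geometric sequence of scales;
* `not_sparseGoodScales_iff_profile` — the NEGATION of the crux is exactly a "Silverman-profile"
  sequence: some `δ₀ > 0` such that below every large power `q^j` there is an abc triple of radical
  `≤ q^j` and height `> (q^j)^{1+δ₀}` — the growth profile realised by `(1, q^{nj} − 1, q^{nj})` in
  the all-Wieferich world of `Theorems/FeketeScalesSparseGoodScalesWieferich.lean`
  (`sparseGoodScales_rad_family_le_of_levels_ge`), with the support of `c` set free.  The distance
  between the crux and its Wieferich floor (p99695) is thus "`c ∈ q^ℕ` versus `c` arbitrary".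

What is NOT here: any instance of goodness (no scale is certified good for any `δ` beyond the finite
tables; `Theorems/SparseGoodScales/Negative/ScaleCensus.lean` records certified BAD scales).
-/

-- `Summit.<Summit>.<Problem>` is the mandated summit-side namespace (CONVENTIONS §2); for the
-- single-conjunct summit `ABC` the two coincide, so the duplicate `ABC.ABC` is deliberate.
set_option linter.dupNamespace false

namespace Summit.ABC.ABC.Theorems.SparseGoodScales

open Literature.NumberTheory.DiophantineGeometry
open Summit.ABC.ABC.Theses.FeketeScales

/-- Rounding a good scale down to a power of `q`: if `R` is `δ/2`-good, `q^j ≤ R < q^{j+1}` and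
`j ≥ 2/δ + 1`, then `q^j` is `δ`-good. [folklore] -/
theorem goodScale_pow_of_goodScale {q : ℕ} (hq : 2 ≤ q) {δ : ℝ} (hδ : 0 < δ) {R j : ℕ}
    (hjR : q ^ j ≤ R) (hRj : R < q ^ (j + 1)) (hj : 2 / δ + 1 ≤ (j : ℝ))
    (hgood : ∀ a b c : ℕ, IsABCTriple a b c → rad a b c ≤ R → (c : ℝ) ≤ (R : ℝ) ^ (1 + δ / 2)) :
    ∀ a b c : ℕ, IsABCTriple a b c → rad a b c ≤ q ^ j →
      (c : ℝ) ≤ ((q ^ j : ℕ) : ℝ) ^ (1 + δ) := by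
  intro a b c habc hr
  have hq1 : (1 : ℝ) ≤ (q : ℝ) := by exact_mod_cast (le_trans (by norm_num) hq : 1 ≤ q)
  have hq0 : (0 : ℝ) ≤ (q : ℝ) := by linarith
  have hR0 : (0 : ℝ) ≤ (R : ℝ) := Nat.cast_nonneg R
  have hc : (c : ℝ) ≤ (R : ℝ) ^ (1 + δ / 2) := hgood a b c habc (le_trans hr hjR)
  have hRq : (R : ℝ) ≤ (q : ℝ) ^ (j + 1) := by exact_mod_cast hRj.le
  -- exponent bookkeeping: (j+1)(1+δ/2) ≤ j(1+δ)
  have hjδ : 2 + δ ≤ (j : ℝ) * δ := by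
    have h1 : (2 / δ + 1) * δ ≤ (j : ℝ) * δ := mul_le_mul_of_nonneg_right hj hδ.le
    have h2 : (2 / δ + 1) * δ = 2 + δ := by field_simp
    linarith
  have hexp : ((j : ℝ) + 1) * (1 + δ / 2) ≤ (j : ℝ) * (1 + δ) := by nlinarith
  calc (c : ℝ) ≤ (R : ℝ) ^ (1 + δ / 2) := hc
    _ ≤ ((q : ℝ) ^ (j + 1)) ^ (1 + δ / 2) := Real.rpow_le_rpow hR0 hRq (by linarith)
    _ = (q : ℝ) ^ (((j : ℝ) + 1) * (1 + δ / 2)) := by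
        rw [← Real.rpow_natCast (q : ℝ) (j + 1), ← Real.rpow_mul hq0]
        push_cast
        ring_nf
    _ ≤ (q : ℝ) ^ ((j : ℝ) * (1 + δ)) := Real.rpow_le_rpow_of_exponent_le hq1 hexp
    _ = ((q ^ j : ℕ) : ℝ) ^ (1 + δ) := by
        rw [Nat.cast_pow, ← Real.rpow_natCast (q : ℝ) j, ← Real.rpow_mul hq0]

/-- **Geometric discretisation, hard direction.** Good scales beyond every bound give good
POWERS OF `q` beyond every bound (any base `q ≥ 2`). [folklore] -/
theorem geometric_of_sparseGoodScales {q : ℕ} (hq : 2 ≤ q) (h : SparseGoodScales) :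
    ∀ δ : ℝ, 0 < δ → ∀ N : ℕ, ∃ j : ℕ, N ≤ j ∧ ∀ a b c : ℕ, IsABCTriple a b c →
      rad a b c ≤ q ^ j → (c : ℝ) ≤ ((q ^ j : ℕ) : ℝ) ^ (1 + δ) := by
  intro δ hδ N
  obtain ⟨j₀, hj₀⟩ := exists_nat_ge (2 / δ + 1)
  obtain ⟨R, hRN, hgood⟩ := h (δ / 2) (by linarith) (q ^ max N j₀)
  have hq1 : 1 < q := lt_of_lt_of_le (by norm_num) hq
  have hR0 : R ≠ 0 := by
    have : 0 < q ^ max N j₀ := pow_pos (by omega) _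
    omega
  set j := Nat.log q R with hj
  have hjR : q ^ j ≤ R := Nat.pow_log_le_self q hR0
  have hRj : R < q ^ (j + 1) := Nat.lt_pow_succ_log_self hq1 R
  have hmax : max N j₀ ≤ j := Nat.le_log_of_pow_le hq1 hRN
  refine ⟨j, le_trans (le_max_left _ _) hmax, ?_⟩
  have hjge : 2 / δ + 1 ≤ (j : ℝ) := by
    have : (j₀ : ℝ) ≤ (j : ℝ) := by exact_mod_cast le_trans (le_max_right _ _) hmax
    linarith
  exact goodScale_pow_of_goodScale hq hδ hjR hRj hjge hgood

/-- **Geometric discretisation, easy direction.** [folklore] -/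
theorem sparseGoodScales_of_geometric {q : ℕ} (hq : 2 ≤ q)
    (h : ∀ δ : ℝ, 0 < δ → ∀ N : ℕ, ∃ j : ℕ, N ≤ j ∧ ∀ a b c : ℕ, IsABCTriple a b c →
      rad a b c ≤ q ^ j → (c : ℝ) ≤ ((q ^ j : ℕ) : ℝ) ^ (1 + δ)) :
    SparseGoodScales := by
  intro δ hδ N
  obtain ⟨j, hjN, hgood⟩ := h δ hδ N
  have hq1 : 1 < q := lt_of_lt_of_le (by norm_num) hq
  refine ⟨q ^ j, le_trans hjN (Nat.lt_pow_self hq1).le, hgood⟩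

/-- **`SparseGoodScales` ⟺ good powers of `q` beyond every bound** (every base `q ≥ 2`): the
crux may be decided along ONE geometric sequence of scales. [folklore] -/
theorem sparseGoodScales_iff_geometric {q : ℕ} (hq : 2 ≤ q) :
    SparseGoodScales ↔ ∀ δ : ℝ, 0 < δ → ∀ N : ℕ, ∃ j : ℕ, N ≤ j ∧ ∀ a b c : ℕ, IsABCTriple a b c →
      rad a b c ≤ q ^ j → (c : ℝ) ≤ ((q ^ j : ℕ) : ℝ) ^ (1 + δ) :=
  ⟨geometric_of_sparseGoodScales hq, sparseGoodScales_of_geometric hq⟩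

/-- **The negation of the crux is a Silverman-profile sequence.** `¬ SparseGoodScales` iff for
some `δ₀ > 0`, below every large power `q^j` there is an abc triple with radical `≤ q^j` and
height `> (q^j)^{1+δ₀}` — the growth profile of `(1, q^{nj} − 1, q^{nj})` in the all-Wieferich
world (`sparseGoodScales_rad_family_le_of_levels_ge`), with the support of `c` unconstrained.
[folklore] -/
theorem not_sparseGoodScales_iff_profile {q : ℕ} (hq : 2 ≤ q) :
    ¬ SparseGoodScales ↔ ∃ δ : ℝ, 0 < δ ∧ ∃ N : ℕ, ∀ j : ℕ, N ≤ j →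
      ∃ a b c : ℕ, IsABCTriple a b c ∧ rad a b c ≤ q ^ j ∧
        ((q ^ j : ℕ) : ℝ) ^ (1 + δ) < (c : ℝ) := by
  rw [sparseGoodScales_iff_geometric hq]
  push Not
  rfl

/-- **`SparseGoodScales` ⟺ good powers of two beyond every bound, registered form** (the sub-goal
of stmt-ABC-2161 this file serves, on one line: it is the signature registered on the item): the crux may be decided along the single geometric sequence of scales `2^j`.  This is
`sparseGoodScales_iff_geometric` at `q = 2`. [folklore] -/
theorem sparseGoodScales_iff_goodPowersOfTwo : Summit.ABC.ABC.Theses.FeketeScales.SparseGoodScales ↔ ∀ δ : ℝ, 0 < δ → ∀ N : ℕ, ∃ j : ℕ, N ≤ j ∧ ∀ a b c : ℕ, IsABCTriple a b c → rad a b c ≤ 2 ^ j → (c : ℝ) ≤ ((2 ^ j : ℕ) : ℝ) ^ (1 + δ) :=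
  sparseGoodScales_iff_geometric (q := 2) le_rfl

end Summit.ABC.ABC.Theorems.SparseGoodScales
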